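import Literature.AlgebraicGeometry.AbelianVarieties.PicZeroCohomologyVanishing
import Literature.AlgebraicGeometry.AbelianVarieties.LineBundleCohomologyIndexTheorem
import Literature.AlgebraicGeometry.Modules.ModuleCechFiniteOverField
import Literature.Algebra.Homology.HomologyAddEquivTransfer
import Literature.AlgebraicGeometry.Modules.ExtCohomologyComparison
import Literature.AlgebraicGeometry.Motives.AbelianVarietyDegree
import HarnessLib

/-!
# `Hⁱ(A, L) = 0` for a non-trivial `L ∈ Pic⁰(A)`, in Mathlib's sheaf cohomology `Sheaf.H` — the `Type`-slice of the named fact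
# `AbelianVarietyPicZeroCohomologyVanishing` DISCHARGED (Mumford, *Abelian Varieties*, §8 (vii); Görtz–Wedhorn II, Lemma 27.197)

Layer `Literature/AlgebraicGeometry/AbelianVarieties`, namespace `Literature.AlgebraicGeometry.AbelianVarieties`.  PROOF file (theorems only; no
definition, no named fact, no instance, no notation, no `sorry`).  Cell `hodgecm-mathlib` (D-0151), pay-down programme «H1-DIM in char `p`» — the
transfer of ★ (D1) `PicZeroCohomologyVanishing` (ordered module Čech cohomology, [MumfordAV1970] §8 (vii) in all degrees) to the currency of
the pub-hsemireg named fact ★ `AbelianVarieties.AbelianVarietyPicZeroCohomologyVanishing` (`Sheaf.H` of the abelian sheaf underlying `L`):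

* §1 `subsingleton_cechComplex_homology_comp_iff` — `Ȟⁿ(𝓦, G) = 0` does not depend on the base ring through which the cochain groups are
  read (`ρ` versus `ρ ∘ τ`: same cochains, same differentials; Mathlib `exactAt_iff_isZero_homology` + `moduleCat_exact_iff`);
* §2 **`subsingleton_sheafH_of_isHomogeneous`** — for an abelian variety `A` over an algebraically closed field (`Type 0`), `L` rank one homogeneous
  with `L ≇ 𝒪_A`: `Hᵖ(A, L) = 0` for every `p` — degree `0` through `H⁰ = Γ(A, L)` (Mathlib `Sheaf.H.equiv₀`, ★ (H0)
  `subsingleton_sections_of_isHomogeneous`); degree `n + 1` through Hartshorne III.6.3 (c) ★ `extUnitAddEquivCohomology` (`H = Ext(𝒪, –)`), ordered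
  Leray ★ `exists_ext_addEquiv_homology_cechComplex` (`Ext(𝒪, L) = Ȟ(𝓤, L)` on a finite affine cover of the quasi-compact separated `A`), §1,
  and ★ (D1) `subsingleton_cechComplex_homology_of_isHomogeneous`;
* §3 **`abelianVarietyPicZeroCohomologyVanishing_univ_zero : AbelianVarietyPicZeroCohomologyVanishing.{0}`** — the named fact AT UNIVERSE `0`
  (the universe of every abelian variety of the cell; the named fact itself is universe-polymorphic, and its other slices are NOT claimed —
  ★ (C) `ModuleCechRefinementTransport` ∕ (G5-c) are typed at `Scheme.{0}`).

HC_CM is proved only modulo the printed citations until rung 0 closes — nothing here bears on a summit statement; count-neutral ★ capital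
(it retires the `Type`-slice of one pub-hsemireg named fact, cf. B-p04 (g39)'s (s2-D) census 22:12:36Z).

## References
* [MumfordAV1970] D. Mumford, *Abelian Varieties* (1970), §8 (vii) (p. 76).
* [GortzWedhorn2023] U. Görtz, T. Wedhorn, *Algebraic Geometry II* (2023), Lemma 27.197 (PDF p. 893), Thm. 22.9 (p. 236).
* [Hartshorne1977] R. Hartshorne, *Algebraic Geometry* (1977), III Prop. 6.3 (c), III Thm. 4.5, III Ex. 4.4 (c).
-/

noncomputable section

-- `Scheme.Modules` are not reducible (as in ★ (D1)).
set_option backward.isDefEq.respectTransparency false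

open CategoryTheory CategoryTheory.Limits CategoryTheory.Abelian AlgebraicGeometry TopologicalSpace Opposite
open Literature.Algebra.Homology Literature.Algebra.Homology.OrderedCech

namespace Literature.AlgebraicGeometry.AbelianVarieties

open Literature.AlgebraicGeometry.Motives Literature.AlgebraicGeometry.Modules Literature.AlgebraicGeometry.Morphisms
  Literature.AlgebraicGeometry.HodgeTheory Literature.AlgebraicGeometry.AbelianSchemes
  Literature.AlgebraicGeometry.AbelianSchemes.AbelianVarietyCech Literature.Algebra.Homology

/-! ## §1 The base ring is irrelevant to `Ȟⁿ⁺¹` (the transfer of ★ `ModuleCechFiniteOverField` §1, as an additive isomorphism) -/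

section BaseRing

variable {X : Scheme.{0}} {ι : Type} [LinearOrder ι] (W : ι → X.Opens) (G : X.Modules)
  {A A₀ : Type} [CommRing A] [CommRing A₀] (ρ : A₀ →+* Γ(X, ⊤)) (τ : A →+* A₀)

omit [LinearOrder ι] in
/-- The Čech sign `ε(s, a) ∈ R` acts on sections as the INTEGER sign (so it does not see the base ring). [folklore]
[cite: GortzWedhorn2023, Def. 21.68 (p. 180)] -/
private theorem sign_smul_eq_int_sign_smul' {R : Type} [CommRing R] (ρ' : R →+* Γ(X, ⊤)) {V : X.Opens} [LinearOrder ι]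
    (s : Finset ι) (a : ι) (x : SecMod G ρ' V) :
    (OrderedCech.sign R s a • x : SecMod G ρ' V) = OrderedCech.sign ℤ s a • x := by
  unfold OrderedCech.sign
  rw [← Int.cast_smul_eq_zsmul R, Int.cast_pow, Int.cast_neg, Int.cast_one]

omit [LinearOrder ι] in
/-- `SecMod.val` of an integer multiple. [folklore] [cite: GortzWedhorn2023, Def. 21.68 (p. 180)] -/
private theorem val_zsmul' {R : Type} [CommRing R] (ρ' : R →+* Γ(X, ⊤)) {V : X.Opens} (z : ℤ) (x : SecMod G ρ' V) :
    SecMod.val (L := G) (ρ := ρ') (z • x) = z • SecMod.val (L := G) (ρ := ρ') x :=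
  map_zsmul (⟨⟨SecMod.val (L := G) (ρ := ρ'), SecMod.val_zero⟩, SecMod.val_add⟩ : SecMod G ρ' V →+ Γ(G, V)) z x

omit [LinearOrder ι] in
/-- `SecMod.val` of a finite sum. [folklore] [cite: GortzWedhorn2023, Def. 21.68 (p. 180)] -/
private theorem val_sum' {R : Type} [CommRing R] (ρ' : R →+* Γ(X, ⊤)) {V : X.Opens} {κ : Type*} (t : Finset κ)
    (f : κ → SecMod G ρ' V) :
    SecMod.val (L := G) (ρ := ρ') (∑ i ∈ t, f i) = ∑ i ∈ t, SecMod.val (L := G) (ρ := ρ') (f i) :=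
  map_sum (⟨⟨SecMod.val (L := G) (ρ := ρ'), SecMod.val_zero⟩, SecMod.val_add⟩ : SecMod G ρ' V →+ Γ(G, V)) f t

/-- **`Ȟⁿ⁺¹(𝓦, G)` does not depend on the base ring**: for `ρ : A₀ → Γ(X, 𝒪)` and `τ : A → A₀`, the ordered module Čech complexes of `G`
read through `ρ ∘ τ` and through `ρ` have additively isomorphic cohomology in every positive degree — the same `ℕ`-indexed complex of abelian
groups maps identically onto both (the transfer ★ `HomologyTransfer.homologyAddEquiv`; verbatim the construction inside ★
`module_finite_homology_cechComplex_comp_succ_of_surjective`, here exported as an isomorphism).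
[cite: GortzWedhorn2023, Def. 21.68 (p. 180)] -/
theorem nonempty_homology_cechComplex_comp_addEquiv (n : ℕ) :
    Nonempty (((cechComplex W G (ρ.comp τ)).homology ((n + 1 : ℕ) : ℤ) : Type) ≃+
      ((cechComplex W G ρ).homology ((n + 1 : ℕ) : ℤ) : Type)) := by
  classical
  let C₁ : CochainComplex (ModuleCat.{0} A₀) ℤ := cechComplex W G ρ
  let C₂ : CochainComplex (ModuleCat.{0} A) ℤ := cechComplex W G (ρ.comp τ)
  have hd₁ : ∀ (m : ℕ) (y : OrderedCech.SysCochain (sectionsSystem W G ρ) (m : ℤ)),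
      (C₁.d (m : ℤ) ((m + 1 : ℕ) : ℤ)).hom y = OrderedCech.sysD (sectionsSystem W G ρ) (m : ℤ) y := fun m y => by
    change (C₁.d (m : ℤ) ((m : ℤ) + 1)).hom y = _
    rw [OrderedCech.sysComplex_d]
    rfl
  have hd₂ : ∀ (m : ℕ) (y : OrderedCech.SysCochain (sectionsSystem W G (ρ.comp τ)) (m : ℤ)),
      (C₂.d (m : ℤ) ((m + 1 : ℕ) : ℤ)).hom y = OrderedCech.sysD (sectionsSystem W G (ρ.comp τ)) (m : ℤ) y := fun m y => by
    change (C₂.d (m : ℤ) ((m : ℤ) + 1)).hom y = _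
    rw [OrderedCech.sysComplex_d]
    rfl
  have hdd : ∀ m : ℕ, AddCommGrpCat.ofHom (C₂.d (m : ℤ) ((m + 1 : ℕ) : ℤ)).hom.toAddMonoidHom ≫
      AddCommGrpCat.ofHom (C₂.d ((m + 1 : ℕ) : ℤ) ((m + 1 + 1 : ℕ) : ℤ)).hom.toAddMonoidHom = 0 := fun m => by
    ext x
    have h := congrArg (fun φ => φ.hom x) (C₂.d_comp_d (m : ℤ) ((m + 1 : ℕ) : ℤ) ((m + 1 + 1 : ℕ) : ℤ))
    simp only [ModuleCat.hom_comp, LinearMap.comp_apply, ModuleCat.hom_zero, LinearMap.zero_apply] at h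
    exact h
  let K : CochainComplex AddCommGrpCat.{0} ℕ :=
    CochainComplex.of (fun m => AddCommGrpCat.of (C₂.X (m : ℤ)))
      (fun m => AddCommGrpCat.ofHom (C₂.d (m : ℤ) ((m + 1 : ℕ) : ℤ)).hom.toAddMonoidHom) hdd
  have hKd : ∀ m : ℕ, K.d m (m + 1) = AddCommGrpCat.ofHom (C₂.d (m : ℤ) ((m + 1 : ℕ) : ℤ)).hom.toAddMonoidHom := fun m => by
    change CochainComplex.of.d (V := AddCommGrpCat.{0}) (fun m : ℕ => AddCommGrpCat.of (C₂.X (m : ℤ)))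
      (fun m : ℕ => AddCommGrpCat.ofHom (C₂.d (m : ℤ) ((m + 1 : ℕ) : ℤ)).hom.toAddMonoidHom) m (m + 1) = _
    exact CochainComplex.of_d _ _ m
  let e₂ : ∀ m : ℕ, (K.X m : Type) ≃+ (C₂.X (m : ℤ) : Type) := fun m => AddEquiv.refl _
  let e₁ : ∀ m : ℕ, (K.X m : Type) ≃+ (C₁.X (m : ℤ) : Type) := fun m =>
    { toFun := fun (g : OrderedCech.SysCochain (sectionsSystem W G (ρ.comp τ)) (m : ℤ)) =>
        (fun σ => SecMod.mk (ρ := ρ) (SecMod.val (L := G) (ρ := ρ.comp τ) (g σ)) :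
          OrderedCech.SysCochain (sectionsSystem W G ρ) (m : ℤ))
      invFun := fun (g : OrderedCech.SysCochain (sectionsSystem W G ρ) (m : ℤ)) =>
        (fun σ => SecMod.mk (ρ := ρ.comp τ) (SecMod.val (L := G) (ρ := ρ) (g σ)) :
          OrderedCech.SysCochain (sectionsSystem W G (ρ.comp τ)) (m : ℤ))
      left_inv := fun _ => rfl
      right_inv := fun _ => rfl
      map_add' := fun _ _ => rfl }
  have he₂ : ∀ (m : ℕ) (x : K.X m), e₂ (m + 1) ((K.d m (m + 1)).hom x) = (C₂.d (m : ℤ) ((m + 1 : ℕ) : ℤ)).hom (e₂ m x) :=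
    fun m x => by rw [hKd]; rfl
  have he₁ : ∀ (m : ℕ) (x : K.X m), e₁ (m + 1) ((K.d m (m + 1)).hom x) = (C₁.d (m : ℤ) ((m + 1 : ℕ) : ℤ)).hom (e₁ m x) := by
    intro m x
    rw [hKd]
    change e₁ (m + 1) ((C₂.d (m : ℤ) ((m + 1 : ℕ) : ℤ)).hom x) = _
    rw [hd₁, hd₂]
    funext σ
    apply SecMod.val_injective (L := G) (ρ := ρ)
    change SecMod.val (L := G) (ρ := ρ.comp τ) (OrderedCech.sysD (sectionsSystem W G (ρ.comp τ)) (m : ℤ) x σ) =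
      SecMod.val (L := G) (ρ := ρ) (OrderedCech.sysD (sectionsSystem W G ρ) (m : ℤ) (e₁ m x) σ)
    rw [OrderedCech.sysD_apply, OrderedCech.sysD_apply, val_sum', val_sum']
    refine Finset.sum_congr rfl fun a _ => ?_
    rw [sign_smul_eq_int_sign_smul', sign_smul_eq_int_sign_smul', val_zsmul', val_zsmul']
    rfl
  let h₁ : (K.homology (n + 1) : Type) ≃+ (C₁.homology ((n + 1 : ℕ) : ℤ) : Type) := HomologyTransfer.homologyAddEquiv e₁ he₁ n
  let h₂ : (K.homology (n + 1) : Type) ≃+ (C₂.homology ((n + 1 : ℕ) : ℤ) : Type) := HomologyTransfer.homologyAddEquiv e₂ he₂ n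
  exact ⟨h₂.symm.trans h₁⟩

/-- `Ȟⁿ⁺¹(𝓦, G) = 0` through `ρ ∘ τ` iff through `ρ` (`nonempty_homology_cechComplex_comp_addEquiv`). [cite: GortzWedhorn2023, Def. 21.68 (p. 180)] -/
theorem subsingleton_cechComplex_homology_comp_iff (n : ℕ) :
    Subsingleton ((cechComplex W G (ρ.comp τ)).homology ((n + 1 : ℕ) : ℤ)) ↔
      Subsingleton ((cechComplex W G ρ).homology ((n + 1 : ℕ) : ℤ)) := by
  obtain ⟨e⟩ := nonempty_homology_cechComplex_comp_addEquiv W G ρ τ n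
  exact ⟨fun _ => e.symm.toEquiv.subsingleton, fun _ => e.toEquiv.subsingleton⟩

end BaseRing

/-! ## §2 `Hᵖ(A, L) = 0` in `Sheaf.H` -/

/-- **`Hᵖ(A, L) = 0` for every `p`, for a non-trivial homogeneous line bundle on an abelian variety over an algebraically closed field** — Mathlib's
sheaf cohomology `Sheaf.H` of the abelian sheaf underlying `L` ([MumfordAV1970] §8 (vii); [GortzWedhorn2023] Lemma 27.197).  Degree `0`:
`H⁰ = Γ(A, L) = 0` (★ (H0)); degree `n + 1`: `Hⁿ⁺¹(A, L) ≅ Extⁿ⁺¹(𝒪_A, L)` (★ Hartshorne III.6.3 (c)) `≅ Ȟⁿ⁺¹(𝓤, L)` (★ ordered Leray on a finite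
affine open cover of the quasi-compact separated `A`) `= 0` (★ (D1), through §1).
[cite: MumfordAV1970, §8 (vii) (p. 76)] [cite: GortzWedhorn2023, Lemma 27.197 (PDF p. 893)] [cite: Hartshorne1977, III Prop. 6.3 (c) and III Thm. 4.5] -/
theorem subsingleton_sheafH_of_isHomogeneous {k : Type} [Field k] [IsAlgClosed k] (B : AbelianVariety k) {L : B.X.left.Modules}
    (h₁ : HasRank L 1) (hL : IsHomogeneous B L) (hne : IsEmpty (L ≅ unitModule B.X.left)) (p : ℕ) :
    Subsingleton ((Modules.abSheaf L).H p) := by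
  rcases p with _ | n
  · -- degree `0`: global sections
    haveI : Subsingleton ((Modules.abSheaf L).obj.obj (op ⊤)) := subsingleton_sections_of_isHomogeneous B h₁ hL hne
    exact (Sheaf.H.equiv₀ (Modules.abSheaf L) isTerminalTop).toEquiv.subsingleton
  · -- a finite affine open cover of `A`, indexed by `Fin m`
    obtain ⟨s, hs, e⟩ := (isCompact_iff_finite_and_eq_biUnion_affineOpens (U := (⊤ : B.X.left.Opens))).mp
      (by simpa using isCompact_univ)
    haveI := hs.to_subtype
    obtain ⟨m, ⟨eqv⟩⟩ := Finite.exists_equiv_fin s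
    let V : Fin m → B.X.left.affineOpens := fun j => (eqv.symm j).1
    have hcovs : ⨆ i : s, (i.1.1 : B.X.left.Opens) = ⊤ := by rw [iSup_subtype]; exact e.symm
    have hcov : ⨆ j, (V j).1 = ⊤ := by
      rw [← hcovs]
      exact eqv.symm.iSup_comp (g := fun i : s => (i.1.1 : B.X.left.Opens))
    -- Leray hypotheses (`A` separated)
    have hVa := hUa (AbelianSchemeOver.ofAbelianVariety B) V
    -- ★ (D1) on this cover, read through the base ring `(A → Spec k)♯`
    have hC := subsingleton_cechComplex_homology_of_isHomogeneous B h₁ hL hne V hcov ((n + 1 : ℕ) : ℤ)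
    have hC' : Subsingleton ((cechComplex (fun j => (V j).1) L B.X.hom.appTop.hom).homology ((n + 1 : ℕ) : ℤ)) :=
      (subsingleton_cechComplex_homology_comp_iff (fun j => (V j).1) L B.X.hom.appTop.hom
        (Scheme.ΓSpecIso (.of k)).commRingCatIsoToRingEquiv.symm.toRingHom n).1 hC
    -- ordered Leray: `Extⁿ⁺¹(𝒪, L) ≃ Ȟⁿ⁺¹(𝓤, L)`
    obtain ⟨f, -⟩ := exists_ext_addEquiv_homology_cechComplex B.X.hom (fun j => (V j).1) hcov hVa L
      (isAffineLocalizing_of_isFiniteLocallyFree (HasRank.isFiniteLocallyFree' h₁)) n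
    haveI : Subsingleton (Ext (unitModule B.X.left) L (n + 1)) := f.toEquiv.subsingleton
    -- Hartshorne III.6.3 (c): `Hⁿ⁺¹(A, L) ≃ Extⁿ⁺¹(𝒪, L)`
    exact (extUnitAddEquivCohomology L (n + 1)).symm.toEquiv.subsingleton

/-! ## §3 The named fact at universe `0` -/

/-- **★ `AbelianVarietyPicZeroCohomologyVanishing` AT UNIVERSE `0`, PROVED** ([MumfordAV1970] §8 (vii); [GortzWedhorn2023] Lemma 27.197): for
every abelian variety `A` over an algebraically closed field `k : Type`, every rank-one homogeneous `L` on `A` not isomorphic to `𝒪_A`, and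
every `p`, `Hᵖ(A, L) = 0`.  (The named fact quantifies over a universe-polymorphic `k : Type u`; this is its `u = 0` slice, the universe in which
the cell's abelian varieties live — the other slices are not claimed.) [cite: MumfordAV1970, §8 (vii) (p. 76)]
[cite: GortzWedhorn2023, Lemma 27.197 (PDF p. 893)] -/
theorem abelianVarietyPicZeroCohomologyVanishing_univ_zero : AbelianVarietyPicZeroCohomologyVanishing.{0} :=
  fun _ _ _ B _ h₁ hL hne p => subsingleton_sheafH_of_isHomogeneous B h₁ hL hne p

end Literature.AlgebraicGeometry.AbelianVarieties

end
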